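import Literature.AlgebraicGeometry.HodgeTheory.BlochSemiregularSpreadSmoothComponentsOfSubscheme
import Literature.AlgebraicGeometry.HodgeTheory.ComplexOrientationDegreeFormulaHolds
import HarnessLib

/-!
# `[Z] = Σⱼ ιⱼ_* 1` for a reduced subscheme with smooth components, and the smooth-components form of
# Bloch's theorem from the subscheme form — UNCONDITIONALLY (Fulton's degree formula is a tree theorem)

Family `hodge`, layer `Literature/AlgebraicGeometry/HodgeTheory`. THEOREMS ONLY (no definition, no
named fact; D-0026). `BlochSemiregularSpreadOfSubschemeComponents.lean` proves
`subschemeClass_eq_sum_complexGysin_one` (the fundamental class of a REDUCED closed subscheme whose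
support is the union of pairwise distinct images of closed immersions `ιⱼ : Kⱼ ↪ X` of smooth projective
`d`-folds is `Σⱼ ιⱼ_* 1`; Fulton §1.5 with Lemma 19.1.2, Voisin I §11.1.4) and
`BlochSemiregularSpreadSmoothComponentsOfSubscheme.lean` proves
`blochSemiregularSpreadSmoothComponents_of_subscheme`, both GRANTED the named fact
`Fulton1998_degreeFormula_complexOrientation` (Fulton, Lemma 19.1.2, for the complex orientations).
That named fact is DISCHARGED in the tree (`Fulton1998_degreeFormula_complexOrientation_holds`,
`ComplexOrientationDegreeFormulaHolds.lean`). This leaf file feeds the discharge in, so that the cell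
`pub-hsemireg` (HodgeConjecture venture; reducible seeds with smooth components, e.g. Schoen's
`Δ_J ∪ (C × C)`) cites NO named fact for the class identity `[Z] = Σⱼ ιⱼ_* 1`, and records that the
fundamental class `subschemeClass hX hdp ρ i hi` does not depend on the resolution family `ρ`
(`cycleClass_eq_of_hasDegreeFormula`, Voisin I §11.1.4 "does not depend on the choice of
desingularization"):

* `subschemeClass_eq_of_resolutionFamily` — `[Z]` through `ρ` = `[Z]` through `ρ'`, for every closed
  subscheme `Z` with `[Z] ∈ Z_d(X)`;
* `subschemeClass_eq_sum_complexGysin_one'` — `[Z] = Σⱼ ιⱼ_* 1`, hypothesis-free form;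
* `blochSemiregularSpreadSmoothComponents_of_subscheme'` —
  `BlochSemiregularSpreadOfSubscheme n p → BlochSemiregularSpreadSmoothComponents n p`.

## References

* [Fulton1998] W. Fulton, Intersection Theory: §1.5 (`[Z] = Σ mᵢ[Zᵢ]`), Lemma 19.1.2 (degree formula),
  §19.1.
* [VoisinHodgeI2002] C. Voisin, Hodge Theory and Complex Algebraic Geometry I, §11.1.4 (`[Z] = τ_* 1`,
  independence of the desingularization).
* [Bloch1972Semiregularity] S. Bloch, Semi-regularity and de Rham cohomology, Invent. Math. 17 (1972):
  §0, Thm. (7.1), Thm. (7.4).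
-/

noncomputable section

open CategoryTheory CategoryTheory.Limits AlgebraicGeometry Opposite TopologicalSpace Order

namespace Literature.AlgebraicGeometry.HodgeTheory

open Literature.AlgebraicGeometry.Motives Literature.AlgebraicTopology.SingularHomology

section Unconditional

variable {n : ℕ} {X : SchemeOver ℂ}

/-- **The fundamental class of a closed subscheme does not depend on the resolution family**
(complex orientations; Fulton's degree formula with `k = 1` on each prime cycle, a tree theorem).
[cite: VoisinHodgeI2002, §11.1.4] [cite: Fulton1998, Lemma 19.1.2] -/
theorem subschemeClass_eq_of_resolutionFamily (hX : IsSmoothProjective n X) {d p : ℕ}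
    (hdp : d + p = n) (ρ ρ' : ResolutionFamily X d) {Z : Scheme.{0}} (i : Z ⟶ X.left)
    (hi : IsClosedImmersion i) [IsLocallyNoetherian Z]
    (hmem : subschemeCycle i hi ∈ cyclesOfDim X.left d) :
    subschemeClass hX hdp ρ i hi = subschemeClass hX hdp ρ' i hi := by
  rw [subschemeClass_eq_cycleClass hX hdp ρ i hi hmem, subschemeClass_eq_cycleClass hX hdp ρ' i hi hmem,
    cycleClass_eq_of_hasDegreeFormula Fulton1998_degreeFormula_complexOrientation_holds hX hdp ρ ρ']

/-- **`[Z] = Σⱼ ιⱼ_* 1` in `H^{2p}(X(ℂ); ℂ)` for a reduced closed subscheme whose support is the union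
of pairwise distinct images of closed immersions of smooth projective `d`-folds** — the hypothesis-free
form of `subschemeClass_eq_sum_complexGysin_one` (Fulton's degree formula fed by its tree discharge
`Fulton1998_degreeFormula_complexOrientation_holds`). [cite: Fulton1998, §1.5 and Lemma 19.1.2]
[cite: VoisinHodgeI2002, §11.1.4] -/
theorem subschemeClass_eq_sum_complexGysin_one' (hX : IsSmoothProjective n X) {d p : ℕ}
    (hdp : d + p = n) (ρ : ResolutionFamily X d) {Z : Scheme.{0}} (i : Z ⟶ X.left)
    (hi : IsClosedImmersion i) [IsLocallyNoetherian Z] [IsReduced Z] {J : Type} [Fintype J]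
    {K : J → SchemeOver ℂ} (hK : ∀ j, IsSmoothProjective d (K j)) (ι : ∀ j, K j ⟶ X)
    (hι : ∀ j, IsClosedImmersion (ι j).left)
    (hinj : Function.Injective fun j ↦ Set.range (ι j).left.base)
    (hcover : Set.range i.base = ⋃ j, Set.range (ι j).left.base) :
    subschemeClass hX hdp ρ i hi =
      ∑ j, complexGysin complexOrientationFamily (hK j) hX (ι j)
        (show 0 + 2 * n = 2 * p + 2 * d by omega)
        (singularCohomology.one ℂ (Motives.ComplexPoints (K j))) :=
  subschemeClass_eq_sum_complexGysin_one Fulton1998_degreeFormula_complexOrientation_holds hX hdp ρ i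
    hi hK ι hι hinj hcover

/-- **The smooth-components form of Bloch's theorem follows from the subscheme form, unconditionally**:
`BlochSemiregularSpreadOfSubscheme n p → BlochSemiregularSpreadSmoothComponents n p`
(`blochSemiregularSpreadSmoothComponents_of_subscheme` with Fulton's degree formula discharged).
[cite: Bloch1972Semiregularity, Thm. (7.4) with §0 and Thm. (7.1)] [cite: Fulton1998, §1.5 and Lemma 19.1.2] -/
theorem blochSemiregularSpreadSmoothComponents_of_subscheme' {n p : ℕ}
    (h : BlochSemiregularSpreadOfSubscheme n p) : BlochSemiregularSpreadSmoothComponents n p :=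
  blochSemiregularSpreadSmoothComponents_of_subscheme Fulton1998_degreeFormula_complexOrientation_holds h

end Unconditional

end Literature.AlgebraicGeometry.HodgeTheory

end
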